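import Literature.NumberTheory.NumberFields.EisensteinFieldSelmer
import HarnessLib

/-!
# `K(S, 3)` of `ℚ(ζ₃)`, `S = {λ, 2, 5}`: the classes whose NORM is a rational cube are `[ζ^i]` only
# (Cohen–Pazuki's `G₃` — «classes of `K*/K*³` whose norm is a cube» — meets the `S`-box in `⟨[ζ₃]⟩`)

Topic `NumberTheory/NumberFields`. Sequel of `EisensteinFieldSelmer` (normal forms
`b = s ζ^i (ζ − 1)^j 2^k 5^l w³` of the elements of `K3 = ℚ(ζ₃)` with `3 ∣ ord_v(b)` for all `v ∌ 30`).
In the `3`-isogeny descent of Cohen–Pazuki ([CohenPazuki2009], Definition 1.3) the descent map of a curve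
`y² = x³ + D̂(âx + b̂)²` with `D̂ = −3` takes values in «the subgroup `G₃` of classes of elements of
`K*/K*³` whose norm is a cube», `K = ℚ(√−3)`; for the rational points these classes are moreover
unramified outside the primes dividing `2b̂√−3` (Theorem 2.1 (2)). When those primes are `λ, 2, 5`
(e.g. the cross-prime carrier `y² − 21xy + 6137y = x³` of route ShaPrimaryTransfer, `2b̂ = 19440 = 2⁴3⁵5`),
the present file computes the resulting box: it is `{[1], [ζ], [ζ²]}`.

* `K3.norm_zeta`, `norm_zeta_sub_one`, `norm_two`, `norm_five`: `N(ζ) = 1`, `N(ζ − 1) = 3`, `N(2) = 4`,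
  `N(5) = 25` (Mathlib's `QuadraticAlgebra.norm`, `N(z) = z z̄`).
* `K3.norm_normalForm`: `N(s ζ^i (ζ−1)^j 2^k 5^l w³) = 3^j 4^k 25^l N(w)³`.
* **`K3.exponents_eq_zero_of_norm_cube`**: if that norm is a rational cube then `j = k = l = 0`
  (valuations at `3`, `2`, `5` of `3^j 4^k 25^l = t³`).
* **`K3.exists_cubeClass_eq_zeta_pow_of_norm_cube`** — for `b ∈ K3ˣ` with `3 ∣ ord_v(b)` for all finite
  `v ∌ 30` and `N(b)` a rational cube: `[b] = [ζ^i]` for some `i < 3`. This is `G₃ ∩ K(S, 3) = ⟨[ζ]⟩`.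

## References

* [CohenPazuki2009] H. Cohen, F. Pazuki, Acta Arith. 140 (2009), Definition 1.3 (`G₃`), Theorem 2.1.
* [SilvermanAEC2009] J. H. Silverman, *AEC* 2nd ed., Prop. VIII.1.6 (`K(S, n)`).
* Tree: `EisensteinField` (`K3`, `zeta`, `conj`), `EisensteinFieldSelmer` (`exists_normal_form`).
-/

noncomputable section

open QuadraticAlgebra NumberField IsDedekindDomain IsDedekindDomain.HeightOneSpectrum
open WithZero (log exp)
open scoped WithZero
open Literature.NumberTheory.EllipticCurves.MordellDescent (cubeClass CubeUnits cubeClass_mul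
  cubeClass_neg cubeClass_mul_pow_three cubeClass_eq_cubeClass_iff cubeClass_pow_three)

namespace Literature.NumberTheory.NumberFields

namespace K3

/-! ## Norms of the generators -/

/-- `N(ζ) = 1`. [cite: CohenPazuki2009, Definition 1.3 (G₃: norms modulo cubes)] -/
theorem norm_zeta : QuadraticAlgebra.norm zeta = 1 := by
  rw [norm_def, zeta_eq]; norm_num

/-- `N(ζ − 1) = 3`. [cite: CohenPazuki2009, Definition 1.3 (G₃: norms modulo cubes)] -/
theorem norm_zeta_sub_one : QuadraticAlgebra.norm (zeta - 1) = 3 := by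
  rw [norm_def, zeta_eq]
  simp only [QuadraticAlgebra.re_sub, QuadraticAlgebra.im_sub, QuadraticAlgebra.re_one,
    QuadraticAlgebra.im_one]
  norm_num

/-- `N(2) = 4`. [cite: CohenPazuki2009, Definition 1.3 (G₃: norms modulo cubes)] -/
theorem norm_two : QuadraticAlgebra.norm (2 : K3) = 4 := by
  rw [show (2 : K3) = ((2 : ℕ) : K3) by norm_num, QuadraticAlgebra.norm_natCast]; norm_num

/-- `N(5) = 25`. [cite: CohenPazuki2009, Definition 1.3 (G₃: norms modulo cubes)] -/
theorem norm_five : QuadraticAlgebra.norm (5 : K3) = 25 := by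
  rw [show (5 : K3) = ((5 : ℕ) : K3) by norm_num, QuadraticAlgebra.norm_natCast]; norm_num

/-- `N(s) = 1` for `s = ±1`. [folklore] -/
private theorem norm_sign {s : ℤ} (hs : s = 1 ∨ s = -1) : QuadraticAlgebra.norm ((s : ℤ) : K3) = 1 := by
  rw [norm_intCast]; rcases hs with rfl | rfl <;> norm_num

/-- **The norm of a normal form**: `N(s ζ^i (ζ−1)^j 2^k 5^l w³) = 3^j 4^k 25^l N(w)³`.
[cite: CohenPazuki2009, Definition 1.3 (G₃)] -/
theorem norm_normalForm {s : ℤ} (hs : s = 1 ∨ s = -1) (i j k l : ℕ) (w : K3) :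
    QuadraticAlgebra.norm ((s : K3) * zeta ^ i * (zeta - 1) ^ j * 2 ^ k * 5 ^ l * w ^ 3) =
      3 ^ j * 4 ^ k * 25 ^ l * (QuadraticAlgebra.norm w) ^ 3 := by
  simp only [map_mul, map_pow, norm_zeta, norm_zeta_sub_one, norm_two, norm_five, norm_sign hs]
  ring

/-- `N(w) ≠ 0` for `w ≠ 0` (`K3` is a field: `N(w) = w w̄`). [folklore] -/
private theorem norm_ne_zero {w : K3} (hw : w ≠ 0) : QuadraticAlgebra.norm w ≠ 0 := by
  intro h0
  have h := algebraMap_norm_eq_mul_star w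
  rw [h0, map_zero] at h
  rcases mul_eq_zero.mp h.symm with h1 | h1
  · exact hw h1
  · exact hw (star_eq_zero.mp h1)

/-! ## The norm-cube condition kills `λ`, `2`, `5` -/

/-- `v_p(3^j 4^k 25^l)` at `p = 3, 2, 5`: `j`, `2k`, `2l`. [folklore] -/
private theorem padicValRat_three_two_five (j k l : ℕ) :
    padicValRat 3 ((3 : ℚ) ^ j * 4 ^ k * 25 ^ l) = j ∧
      padicValRat 2 ((3 : ℚ) ^ j * 4 ^ k * 25 ^ l) = 2 * k ∧
      padicValRat 5 ((3 : ℚ) ^ j * 4 ^ k * 25 ^ l) = 2 * l := by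
  haveI : Fact (Nat.Prime 3) := ⟨Nat.prime_three⟩
  haveI : Fact (Nat.Prime 2) := ⟨Nat.prime_two⟩
  haveI : Fact (Nat.Prime 5) := ⟨by decide⟩
  have h3 : (3 : ℚ) ^ j ≠ 0 := pow_ne_zero _ (by norm_num)
  have h4 : (4 : ℚ) ^ k ≠ 0 := pow_ne_zero _ (by norm_num)
  have h25 : (25 : ℚ) ^ l ≠ 0 := pow_ne_zero _ (by norm_num)
  have e4 : (4 : ℚ) = ((2 : ℕ) : ℚ) ^ 2 := by norm_num
  have e25 : (25 : ℚ) = ((5 : ℕ) : ℚ) ^ 2 := by norm_num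
  have e3 : (3 : ℚ) = ((3 : ℕ) : ℚ) := by norm_num
  have v33 : padicValRat 3 (3 : ℚ) = 1 := by rw [e3]; exact padicValRat.self (by norm_num)
  have v22 : padicValRat 2 ((2 : ℕ) : ℚ) = 1 := padicValRat.self (by norm_num)
  have v55 : padicValRat 5 ((5 : ℕ) : ℚ) = 1 := padicValRat.self (by norm_num)
  have v32 : padicValRat 3 ((2 : ℕ) : ℚ) = 0 := by
    rw [padicValRat.of_nat]; simp [padicValNat.eq_zero_of_not_dvd (by norm_num : ¬ 3 ∣ 2)]
  have v35 : padicValRat 3 ((5 : ℕ) : ℚ) = 0 := by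
    rw [padicValRat.of_nat]; simp [padicValNat.eq_zero_of_not_dvd (by norm_num : ¬ 3 ∣ 5)]
  have v23 : padicValRat 2 (3 : ℚ) = 0 := by
    rw [e3, padicValRat.of_nat]; simp [padicValNat.eq_zero_of_not_dvd (by norm_num : ¬ 2 ∣ 3)]
  have v25 : padicValRat 2 ((5 : ℕ) : ℚ) = 0 := by
    rw [padicValRat.of_nat]; simp [padicValNat.eq_zero_of_not_dvd (by norm_num : ¬ 2 ∣ 5)]
  have v53 : padicValRat 5 (3 : ℚ) = 0 := by
    rw [e3, padicValRat.of_nat]; simp [padicValNat.eq_zero_of_not_dvd (by norm_num : ¬ 5 ∣ 3)]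
  have v52 : padicValRat 5 ((2 : ℕ) : ℚ) = 0 := by
    rw [padicValRat.of_nat]; simp [padicValNat.eq_zero_of_not_dvd (by norm_num : ¬ 5 ∣ 2)]
  refine ⟨?_, ?_, ?_⟩
  · rw [padicValRat.mul (mul_ne_zero h3 h4) h25, padicValRat.mul h3 h4, padicValRat.pow, padicValRat.pow,
      padicValRat.pow, e4, e25, padicValRat.pow, padicValRat.pow, v33, v32, v35]
    ring
  · rw [padicValRat.mul (mul_ne_zero h3 h4) h25, padicValRat.mul h3 h4, padicValRat.pow, padicValRat.pow,
      padicValRat.pow, e4, e25, padicValRat.pow, padicValRat.pow, v23, v22, v25]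
    ring
  · rw [padicValRat.mul (mul_ne_zero h3 h4) h25, padicValRat.mul h3 h4, padicValRat.pow, padicValRat.pow,
      padicValRat.pow, e4, e25, padicValRat.pow, padicValRat.pow, v53, v52, v55]
    ring

/-- **The norm-cube condition**: if `N(s ζ^i (ζ−1)^j 2^k 5^l w³)` is the cube of a rational number
(`w ≠ 0`, `j, k, l < 3`) then `j = k = l = 0` — `3^j 4^k 25^l` must be a cube, and its valuations at
`3, 2, 5` are `j, 2k, 2l`. [cite: CohenPazuki2009, Definition 1.3 (G₃) with Theorem 2.1] -/
theorem exponents_eq_zero_of_norm_cube {s : ℤ} (hs : s = 1 ∨ s = -1) {i j k l : ℕ}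
    (hj : j < 3) (hk : k < 3) (hl : l < 3) {w : K3} (hw : w ≠ 0) {r : ℚ}
    (hr : QuadraticAlgebra.norm ((s : K3) * zeta ^ i * (zeta - 1) ^ j * 2 ^ k * 5 ^ l * w ^ 3) = r ^ 3) :
    j = 0 ∧ k = 0 ∧ l = 0 := by
  haveI : Fact (Nat.Prime 3) := ⟨Nat.prime_three⟩
  haveI : Fact (Nat.Prime 2) := ⟨Nat.prime_two⟩
  haveI : Fact (Nat.Prime 5) := ⟨by decide⟩
  rw [norm_normalForm hs] at hr
  have hN := norm_ne_zero hw
  set N := QuadraticAlgebra.norm w with hNdef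
  have hA : (3 : ℚ) ^ j * 4 ^ k * 25 ^ l ≠ 0 :=
    mul_ne_zero (mul_ne_zero (pow_ne_zero _ (by norm_num)) (pow_ne_zero _ (by norm_num)))
      (pow_ne_zero _ (by norm_num))
  have hr0 : r ≠ 0 := by
    rintro rfl
    rw [zero_pow three_ne_zero] at hr
    exact (mul_ne_zero hA (pow_ne_zero 3 hN)) hr
  -- `3^j 4^k 25^l = (r / N)³`
  have key : (3 : ℚ) ^ j * 4 ^ k * 25 ^ l = (r / N) ^ 3 := by
    rw [div_pow, eq_div_iff (pow_ne_zero 3 hN), hr]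
  obtain ⟨v3, v2, v5⟩ := padicValRat_three_two_five j k l
  have d3 : (3 : ℤ) ∣ (j : ℤ) := ⟨padicValRat 3 (r / N), by rw [← v3, key, padicValRat.pow]; push_cast; ring⟩
  have d2 : (3 : ℤ) ∣ 2 * (k : ℤ) := ⟨padicValRat 2 (r / N), by rw [← v2, key, padicValRat.pow]; push_cast; ring⟩
  have d5 : (3 : ℤ) ∣ 2 * (l : ℤ) := ⟨padicValRat 5 (r / N), by rw [← v5, key, padicValRat.pow]; push_cast; ring⟩
  refine ⟨?_, ?_, ?_⟩ <;> omega

/-- **`G₃ ∩ K(S, 3) = ⟨[ζ]⟩` for `S = {λ, 2, 5}`**: an element `b ∈ K3ˣ` with `3 ∣ ord_v(b)` for every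
finite place `v ∌ 30` and whose norm is a rational cube has cube class `[ζ^i]`, `i < 3`. For the
`3`-descent of Cohen–Pazuki on a curve `y² = x³ − 3(âx + b̂)²` whose `2b̂√−3` is supported on `{λ, 2, 5}`
this is the whole Selmer box of the `ℤ/3ℤ`-kernel side. [cite: CohenPazuki2009, Definition 1.3 and Theorem 2.1] -/
theorem exists_cubeClass_eq_zeta_pow_of_norm_cube {b : K3} (hb : b ≠ 0)
    (hval : ∀ v : HeightOneSpectrum (𝓞 K3), (30 : 𝓞 K3) ∉ v.asIdeal → (3 : ℤ) ∣ log (v.valuation K3 b))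
    (hnorm : ∃ r : ℚ, QuadraticAlgebra.norm b = r ^ 3) :
    ∃ i : ℕ, i < 3 ∧ cubeClass b = cubeClass (zeta ^ i) := by
  obtain ⟨s, i, j, k, l, w, hs, hi, hj, hk, hl, hw, hb_eq⟩ := exists_normal_form hb hval
  obtain ⟨r, hr⟩ := hnorm
  rw [hb_eq] at hr
  obtain ⟨rfl, rfl, rfl⟩ := exponents_eq_zero_of_norm_cube hs hj hk hl hw hr
  refine ⟨i, hi, ?_⟩
  have hz : (zeta : K3) ≠ 0 := isPrimitiveRoot_zeta.ne_zero (by norm_num)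
  have hs0 : (s : K3) ≠ 0 := by rcases hs with rfl | rfl <;> norm_num
  rw [hb_eq, pow_zero, pow_zero, pow_zero, mul_one, mul_one, mul_one,
    cubeClass_mul_pow_three (mul_ne_zero hs0 (pow_ne_zero _ hz)) hw]
  -- `s = s³` for `s = ±1`
  have hs3 : (s : K3) = (s : K3) ^ 3 := by rcases hs with rfl | rfl <;> norm_num
  rw [hs3, mul_comm, cubeClass_mul_pow_three (pow_ne_zero _ hz) hs0]

end K3

end Literature.NumberTheory.NumberFields
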